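import Summits.QuantumFields.YangMills.Theses.ColdStartUniversality
import Summits.QuantumFields.YangMills.Theorems.ColdStartUniversalityColdStartSolutionsExistNoise
import Summits.QuantumFields.YangMills.Theorems.ColdStartUniversalityColdStartSolutionsExistCoordMartingale
import Summits.QuantumFields.YangMills.Theorems.ColdStartUniversalityColdStartSolutionsExistSpanRange
import Summits.QuantumFields.YangMills.Theorems.ColdStartUniversalityColdStartSolutionsExistQuaternion
import Summits.QuantumFields.YangMills.Theorems.ColdStartUniversalityColdStartSolutionsExistTruncated
import Summits.QuantumFields.YangMills.Theorems.ColdStartUniversalityColdStartSolutionsExistAmbientSolution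
import Summits.QuantumFields.YangMills.Theorems.ColdStartUniversalityColdStartSolutionsExistTangentReduce
import Literature.MathematicalPhysics.QuantumLattice.RepLieAlgebraUnitary
import HarnessLib

/-!
# Skeleton for support crux S = `ColdStartSolutionsExist` (stmt-QuantumFields-24811) of route
# `ColdStartUniversality` — `Lines/piwiener.lean`, v7 (lead `ym-line-csu-p1`)

S: for every `F`, `γ > 0`, `K` there are a filtered probability space, a flat Brownian driver `W` and a
cold-start strong solution `U` (`U 0 = 1`) of `latticeLangevinDynamics (SU(2), fundamental) ((γ ε_K)⁻¹/2)`
(SZZ arXiv:2204.12737 §3 Lemma 3.2) on Bałaban's `K`-th lattice.  Line `piwiener`: noise space fixed once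
per lattice size `L` (`Ω_L = (Edge 3 L × NoiseIdx 2) → (ℝ≥0 → ℝ)`, `P_L = ⊗ preWienerMeasure`, coordinate
Brownian motions, flat: `isFlatBrownian_piWiener`).  Architecture: solve a TAME (globally Lipschitz) and
TANGENT modification `S̃` of the SZZ system in the ambient `M₂(ℂ)^E` (stub C, closed: `…Truncated`), by
Itô's existence theorem for Lipschitz systems (stub A, CLOSED v6: vector Picard iteration
`…VecPicardStep/Estimates/Bounds/Limit/VecPicard` run in the quaternion coordinates of `V = span_ℝ SU(2)`,
`…AmbientQuaternion/Coordinates/Solution`, so the solution is `V`-valued surely); the solution keeps the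
Frobenius spheres `‖X_e‖_F² = 2` (stub B, reduced v6 to the generic statement B1 `stub_tangentSumSq` —
"tangent Itô systems keep the sum of squares" — by `…TangentInst`; tools `…TangentTools`); hence it is
`SU(2)`-valued (stub D, closed `…Quaternion`) and solves the SZZ system itself through `ρ` (composition
`coldStart_of_stubs`, kernel-checked).  OPEN: B1 only.  `IsAmbientSolution` (v5) carries the `L²(sup)`
bound.  RECORD-rung R3 plumbing; NOT the Yang–Mills mass gap, not Bałaban's limit, not K_A1/K_A2.
-/

set_option autoImplicit false

noncomputable section

namespace Summit.QuantumFields.YangMills.Cruxes.ColdStartSolutionsExist.Piwiener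

open MeasureTheory ProbabilityTheory Filter Topology
open scoped NNReal ENNReal BigOperators
open Literature.Probability.Process Literature.MathematicalPhysics.QuantumFieldTheory
open Literature.MathematicalPhysics.QuantumLattice (fundamentalRep fundamentalLatticeRep)
open Literature.MathematicalPhysics.QuantumFieldTheory.Balaban1983to89
open Summit.QuantumFields.YangMills.Theorems.ColdStartUniversality
open Summit.QuantumFields.YangMills.Theses.ColdStartUniversality (ColdStartSolutionsExist)

/-! ## Vocabulary of the line (workfile-local abbreviations) -/

/-- The product Wiener noise space over the links × noise directions of `(ℤ/L)³`. -/
abbrev Ωn (L : ℕ) : Type := (Edge 3 L × NoiseIdx 2) → (ℝ≥0 → ℝ)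

/-- Its probability `P_L = ⊗ preWienerMeasure`. -/
abbrev Pn (L : ℕ) [NeZero L] : Measure (Ωn L) := Measure.pi fun _ => preWienerMeasure

/-- The coordinate Brownian family `W t ω i = brownian t (ω i)`. -/
abbrev Wn (L : ℕ) : ℝ≥0 → Ωn L → (Edge 3 L × NoiseIdx 2 → ℝ) := fun t ω i => brownian t (ω i)

/-- `W` is a flat Brownian motion (LANDED, p600306). -/
theorem isFlatBrownian_Wn (L : ℕ) [NeZero L] : IsFlatBrownian (Wn L) (Pn L) :=
  isFlatBrownian_piWiener 3 L (NoiseIdx 2)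

/-- The real span of `SU(2) ⊂ M₂(ℂ)` (the quaternion 4-plane). -/
abbrev V : Submodule ℝ (Matrix (Fin 2) (Fin 2) ℂ) := Submodule.span ℝ (Set.range (fundamentalRep (Fin 2)))

/-- **Tame link SDE**: squared-Frobenius global Lipschitz bounds for drift and noise, and invariance of
the quaternion plane `V` under the coefficients. [folklore] -/
def IsTame {L : ℕ} [NeZero L] (S : LinkSDE 3 L 2 (NoiseIdx 2)) : Prop :=
  (∃ K : ℝ, ∀ (Q Q' : MatrixConfig 3 L 2) (e : Edge 3 L),
      hsForm 2 (S.drift Q e - S.drift Q' e) (S.drift Q e - S.drift Q' e) ≤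
          K * ∑ e', hsForm 2 (Q e' - Q' e') (Q e' - Q' e') ∧
        ∀ n, hsForm 2 (S.noise Q e n - S.noise Q' e n) (S.noise Q e n - S.noise Q' e n) ≤
          K * ∑ e', hsForm 2 (Q e' - Q' e') (Q e' - Q' e')) ∧
    ∀ Q : MatrixConfig 3 L 2, (∀ e, Q e ∈ V) → ∀ e, S.drift Q e ∈ V ∧ ∀ n, S.noise Q e n ∈ V

/-- **Tangency to the Frobenius spheres, Itô-corrected.** [folklore] -/
def IsTangent {L : ℕ} (S : LinkSDE 3 L 2 (NoiseIdx 2)) : Prop :=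
  ∀ (Q : MatrixConfig 3 L 2) (e : Edge 3 L),
    2 * hsForm 2 (S.drift Q e) (Q e) + ∑ n, hsForm 2 (S.noise Q e n) (S.noise Q e n) = 0 ∧
      ∀ n, hsForm 2 (S.noise Q e n) (Q e) = 0

/-- **Ambient strong solution** of the link SDE `S` on the product Wiener space from `Q₀`: adapted to the
joint raw natural filtration AND entrywise (real/imaginary parts) strongly progressive for it (the raw
filtration is not complete, so progressivity is recorded, as the Picard construction provides it and Itô's
formula consumes it), a.s. continuous, in `L²(sup)` on bounded time intervals
(`E[sup_{s≤t} Σ_e ‖X_s e‖_F²] < ∞`, v5: the Picard construction provides it and the norm-preservation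
argument consumes it), `X 0 = Q₀`, and the entrywise Itô integral equations in
`M₂(ℂ)^E` (stochastic integrals = the tree's characterised `IsItoIntegralC`) — `LinkSDE.IsSolution`
without the group. [cite: RevuzYor1999, Ch. IX Def. (1.2) and (1.5)] -/
def IsAmbientSolution {L : ℕ} [NeZero L] (S : LinkSDE 3 L 2 (NoiseIdx 2))
    (hW : IsFlatBrownian (Wn L) (Pn L)) (Q₀ : MatrixConfig 3 L 2)
    (X : ℝ≥0 → Ωn L → MatrixConfig 3 L 2) : Prop :=
  (∀ t, Measurable[hW.natFiltration t] fun ω => (fun e i j => X t ω e i j : Edge 3 L → Fin 2 → Fin 2 → ℂ)) ∧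
    (∀ e i j, IsStronglyProgressive hW.natFiltration (fun t ω => (X t ω e i j).re) ∧
      IsStronglyProgressive hW.natFiltration (fun t ω => (X t ω e i j).im)) ∧
    (∀ᵐ ω ∂Pn L, Continuous fun t => X t ω) ∧
    (∀ t : ℝ≥0, ∫⁻ ω, ⨆ s ∈ Set.Iic t, ENNReal.ofReal (∑ e, hsForm 2 (X s ω e) (X s ω e)) ∂Pn L < ∞) ∧
    (∀ ω, X 0 ω = Q₀) ∧
    ∃ J : Edge 3 L → NoiseIdx 2 → Fin 2 → Fin 2 → ℝ≥0 → Ωn L → ℂ,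
      (∀ e n i j, IsItoIntegralC (fun t ω => S.noise (X t ω) e n i j) (fun t ω => Wn L t ω (e, n))
        (J e n i j) hW.natFiltration (Pn L)) ∧
      ∀ᵐ ω ∂Pn L, ∀ (t : ℝ≥0) (e : Edge 3 L) (i j : Fin 2),
        X t ω e i j = Q₀ e i j + (∫ s in (0 : ℝ)..t, S.drift (X s.toNNReal ω) e i j) + ∑ n, J e n i j t ω

/-! ## Registered stub signatures -/

namespace __Registered

/-- A: generic vector Picard existence on the product Wiener space, values in `V^E`. -/
abbrev stub_ambientStrongExistence : Prop :=
  ∀ (L : ℕ) [NeZero L] (S : LinkSDE 3 L 2 (NoiseIdx 2)), IsTame S →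
    ∀ (hW : IsFlatBrownian (Wn L) (Pn L)) (Q₀ : MatrixConfig 3 L 2), (∀ e, Q₀ e ∈ V) →
      ∃ X : ℝ≥0 → Ωn L → MatrixConfig 3 L 2, IsAmbientSolution S hW Q₀ X ∧ ∀ᵐ ω ∂Pn L, ∀ t e, X t ω e ∈ V

/-- B: generic Frobenius-norm preservation for tame tangent systems (vector Itô product rule). -/
abbrev stub_frobeniusNormPreserved : Prop :=
  ∀ (L : ℕ) [NeZero L] (S : LinkSDE 3 L 2 (NoiseIdx 2)), IsTame S → IsTangent S →
    ∀ (hW : IsFlatBrownian (Wn L) (Pn L)) (Q₀ : MatrixConfig 3 L 2)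
      (X : ℝ≥0 → Ωn L → MatrixConfig 3 L 2), IsAmbientSolution S hW Q₀ X →
      ∀ᵐ ω ∂Pn L, ∀ (t : ℝ≥0) (e : Edge 3 L), hsForm 2 (X t ω e) (X t ω e) = hsForm 2 (Q₀ e) (Q₀ e)

/-- C: a tame, tangent modification of the SZZ system agreeing with it on `SU(2)`-valued configurations. -/
abbrev stub_truncatedCoefficients : Prop :=
  ∀ (L : ℕ) [NeZero L] (β : ℝ), ∃ S : LinkSDE 3 L 2 (NoiseIdx 2), IsTame S ∧ IsTangent S ∧
    ∀ (U : GaugeConfig 3 L (Matrix.specialUnitaryGroup (Fin 2) ℂ)) (e : Edge 3 L),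
      S.drift (matrixConfig (fundamentalRep (Fin 2)) U) e =
          (latticeLangevinDynamics (fundamentalLatticeRep 2) β).drift
            (matrixConfig (fundamentalRep (Fin 2)) U) e ∧
        ∀ n, S.noise (matrixConfig (fundamentalRep (Fin 2)) U) e n =
          (latticeLangevinDynamics (fundamentalLatticeRep 2) β).noise
            (matrixConfig (fundamentalRep (Fin 2)) U) e n

/-- D: the quaternion sphere is the group. -/
abbrev stub_quaternionSphere : Prop :=
  ∀ M : Matrix (Fin 2) (Fin 2) ℂ, M ∈ V → hsForm 2 M M = 2 → M ∈ Set.range (fundamentalRep (Fin 2))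

/-- B1 (v7 = v6 + the `L²(sup)` hypothesis on `σ`; the ONLY open stub): **tangent Itô systems keep the sum of squares** — generic stochastic
calculus on a probability space with a Brownian vector (joint raw filtration): real processes
`Y_k = y_k + ∫₀ b_k ds + Σₙ ∫ σ_{k,n} dW^{c n}` (finitely many `k`, progressive data with continuous paths,
`E ∫₀ᵗ σ² < ∞` and `E sup_{s≤t} σ² < ∞`, `c` injective) with `2 Σ_k Y_k b_k + Σ_{k,n} σ_{k,n}² = 0` and `Σ_k Y_k σ_{k,n} = 0`
pointwise satisfy `Σ_k Y_k(t)² = Σ_k y_k²` for all `t`, a.s. (Itô's formula for `Σ Y_k²`: zero drift,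
zero martingale part). Stub B follows from it (`frobenius_preserved_of_tangent`, LANDED `…TangentInst`). -/
abbrev stub_tangentSumSq : Prop :=
  ∀ {Ω : Type} [MeasurableSpace Ω] {P : Measure Ω} [IsProbabilityMeasure P] {d : ℕ}
    {W : ℝ≥0 → Ω → (Fin d → ℝ)} (hW : IsBrownianVec W P) {ι κ : Type} [Fintype ι] [Fintype κ]
    (c : κ → Fin d) (_hc : Function.Injective c)
    (Y : ι → ℝ≥0 → Ω → ℝ) (b : ι → ℝ≥0 → Ω → ℝ) (σ : ι → κ → ℝ≥0 → Ω → ℝ)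
    (J : ι → κ → ℝ≥0 → Ω → ℝ) (y₀ : ι → ℝ),
    (∀ k, IsStronglyProgressive hW.natFiltration (Y k)) →
    (∀ k, IsStronglyProgressive hW.natFiltration (b k)) →
    (∀ k n, IsStronglyProgressive hW.natFiltration (σ k n)) →
    (∀ᵐ ω ∂P, ∀ k, Continuous fun t => Y k t ω) →
    (∀ᵐ ω ∂P, ∀ k, Continuous fun t => b k t ω) →
    (∀ᵐ ω ∂P, ∀ k n, Continuous fun t => σ k n t ω) →
    (∀ k n (t : ℝ≥0), sqErr (σ k n) 0 P t ≠ ⊤) →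
    (∀ k n (t : ℝ≥0), ∫⁻ ω, ⨆ s ∈ Set.Iic t, ENNReal.ofReal (σ k n s ω ^ 2) ∂P < ⊤) →
    (∀ k n, IsItoIntegral (σ k n) (fun t ω => W t ω (c n)) (J k n) hW.natFiltration P) →
    (∀ᵐ ω ∂P, ∀ (t : ℝ≥0) (k : ι),
      Y k t ω = y₀ k + (∫ s in (0 : ℝ)..t, b k s.toNNReal ω) + ∑ n, J k n t ω) →
    (∀ (t : ℝ≥0) (ω : Ω), 2 * ∑ k, Y k t ω * b k t ω + ∑ k, ∑ n, σ k n t ω ^ 2 = 0) →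
    (∀ (t : ℝ≥0) (ω : Ω) (n : κ), ∑ k, Y k t ω * σ k n t ω = 0) →
    ∀ᵐ ω ∂P, ∀ t : ℝ≥0, ∑ k, Y k t ω ^ 2 = ∑ k, y₀ k ^ 2

end __Registered

/-- **STUB A (CLOSED v6, `ambient_exists_of_tame` of `…AmbientSolution`: vector Picard in quaternion
coordinates, `…VecPicard*`, `…AmbientQuaternion/Coordinates`).** -/
theorem stub_ambientStrongExistence : __Registered.stub_ambientStrongExistence := by
  intro L _ S hS hW Q₀ hQ₀
  obtain ⟨⟨K, hK⟩, hV⟩ := hS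
  haveI := isProbabilityMeasure_piWiener (Edge 3 L × NoiseIdx 2)
  obtain ⟨X, hX, hXV⟩ := ambient_exists_of_tame hW S (fun Q Q' e => (hK Q Q' e).1)
    (fun Q Q' e n => (hK Q Q' e).2 n) hV Q₀ hQ₀
  exact ⟨X, hX, ae_of_all _ fun ω t e => hXV t ω e⟩

/-- **STUB B1 (OPEN, v6)** — see `__Registered.stub_tangentSumSq`; tools landed: `…TangentTools`. -/
theorem stub_tangentSumSq : __Registered.stub_tangentSumSq := by
  sorry

/-- **STUB B (CLOSED v6 modulo B1, `frobenius_preserved_of_tangent` of `…TangentInst`).** -/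
theorem stub_frobeniusNormPreserved_of (hT : __Registered.stub_tangentSumSq) :
    __Registered.stub_frobeniusNormPreserved := by
  intro L _ S hS hTan hW Q₀ X hX
  obtain ⟨⟨K, hK⟩, -⟩ := hS
  haveI := isProbabilityMeasure_piWiener (Edge 3 L × NoiseIdx 2)
  obtain ⟨-, hXp, hXc, hX2, -, J, hJ, hXeq⟩ := hX
  exact frobenius_preserved_of_tangent' hT hW S (fun Q Q' e => (hK Q Q' e).1) (fun Q Q' e n => (hK Q Q' e).2 n)
    (fun Q e => (hTan Q e).1) (fun Q e n => (hTan Q e).2 n) Q₀ hXp hXc hX2 hJ hXeq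

/-- Stub B from the open stub B1. -/
theorem stub_frobeniusNormPreserved : __Registered.stub_frobeniusNormPreserved :=
  stub_frobeniusNormPreserved_of stub_tangentSumSq

/-- **STUB C (CLOSED by the lead, `exists_truncatedCoefficients` of `…ColdStartSolutionsExistTruncated`)** —
see `__Registered.stub_truncatedCoefficients`. -/
theorem stub_truncatedCoefficients : __Registered.stub_truncatedCoefficients :=
  fun L _ β => exists_truncatedCoefficients L β

/-- **STUB D (CLOSED, p602104 `mem_range_fundamentalRep_of_mem_span`).** -/
theorem stub_quaternionSphere : __Registered.stub_quaternionSphere :=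
  fun _ hM h2 => mem_range_fundamentalRep_of_mem_span hM h2

/-! ## Composition lemmas (kernel-checked) -/

section Compose

variable {Ω : Type*} {m : MeasurableSpace Ω} {P : Measure Ω} {𝓕 : Filtration ℝ≥0 m}

/-- Approximating sequences only see the integrand up to a null set of paths. -/
theorem isApproxSeq_congr_ae {Hn : ℕ → SimpleProcess m 𝓕} {H H' : ℝ≥0 → Ω → ℝ}
    (h : ∀ᵐ ω ∂P, ∀ t, H' t ω = H t ω) (hH : SimpleProcess.IsApproxSeq Hn H P) :
    SimpleProcess.IsApproxSeq Hn H' P := by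
  intro t ε hε
  have hset : ∀ n, P {ω | ENNReal.ofReal ε ≤ ∫⁻ s in Set.Icc (0 : ℝ) t,
        ENNReal.ofReal (((Hn n).toProcess s.toNNReal ω - H' s.toNNReal ω) ^ 2)} =
      P {ω | ENNReal.ofReal ε ≤ ∫⁻ s in Set.Icc (0 : ℝ) t,
        ENNReal.ofReal (((Hn n).toProcess s.toNNReal ω - H s.toNNReal ω) ^ 2)} := by
    intro n
    refine measure_congr (Filter.eventuallyEq_set.2 (h.mono fun ω hω => ?_))
    simp only [Set.mem_setOf_eq, hω]
  simp_rw [hset]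
  exact hH t ε hε

/-- **The characterised Itô integral is insensitive to changing the integrand on a null set of paths.** -/
theorem isItoIntegral_congr_ae {H H' B J : ℝ≥0 → Ω → ℝ} (h : ∀ᵐ ω ∂P, ∀ t, H' t ω = H t ω)
    (hJ : IsItoIntegral H B J 𝓕 P) : IsItoIntegral H' B J 𝓕 P := by
  have h' : ∀ᵐ ω ∂P, ∀ t, H t ω = H' t ω := h.mono fun ω hω t => (hω t).symm
  obtain ⟨h0, hc, hM, ⟨Hn, hHn⟩, hucp⟩ := hJ
  exact ⟨h0, hc, hM, ⟨Hn, isApproxSeq_congr_ae h hHn⟩,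
    fun Gn hGn => hucp Gn (isApproxSeq_congr_ae h' hGn)⟩

/-- Complex version. -/
theorem isItoIntegralC_congr_ae {H H' J : ℝ≥0 → Ω → ℂ} {B : ℝ≥0 → Ω → ℝ}
    (h : ∀ᵐ ω ∂P, ∀ t, H' t ω = H t ω) (hJ : IsItoIntegralC H B J 𝓕 P) :
    IsItoIntegralC H' B J 𝓕 P :=
  ⟨isItoIntegral_congr_ae (h.mono fun ω hω t => by rw [hω t]) hJ.1,
    isItoIntegral_congr_ae (h.mono fun ω hω t => by rw [hω t]) hJ.2⟩

end Compose

/-- The measurable retraction `M₂(ℂ) → SU(2)`: identity on `SU(2)`, `1` elsewhere. -/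
def toSU2 (Q : Matrix (Fin 2) (Fin 2) ℂ) : Matrix.specialUnitaryGroup (Fin 2) ℂ :=
  open scoped Classical in
  if h : Q ∈ Matrix.specialUnitaryGroup (Fin 2) ℂ then ⟨Q, h⟩ else 1

/-- `toSU2` is the identity on `SU(2)` (as matrices). -/
theorem coe_toSU2_of_mem {Q : Matrix (Fin 2) (Fin 2) ℂ}
    (h : Q ∈ Matrix.specialUnitaryGroup (Fin 2) ℂ) : (toSU2 Q : Matrix (Fin 2) (Fin 2) ℂ) = Q := by
  unfold toSU2
  rw [dif_pos h]

/-- `toSU2 1 = 1`. -/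
theorem toSU2_one : toSU2 1 = 1 :=
  Subtype.ext (coe_toSU2_of_mem (Submonoid.one_mem _))

/-- As matrices, `toSU2 Q = if Q ∈ SU(2) then Q else 1`. -/
theorem coe_toSU2 (Q : Matrix (Fin 2) (Fin 2) ℂ) :
    (toSU2 Q : Matrix (Fin 2) (Fin 2) ℂ) =
      open scoped Classical in if Q ∈ Matrix.specialUnitaryGroup (Fin 2) ℂ then Q else 1 := by
  unfold toSU2
  split_ifs with h <;> rfl

/-- Measurability into `SU(2)` is measurability of the matrix entries (the Borel σ-algebra of `SU(2)` is
induced by the entries, tree `measurableSpace_specialUnitaryGroup_eq_comap`). -/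
theorem measurable_su2_of_entries {α : Type*} {mα : MeasurableSpace α}
    {f : α → Matrix.specialUnitaryGroup (Fin 2) ℂ}
    (h : Measurable fun a => (fun i j => (f a : Matrix (Fin 2) (Fin 2) ℂ) i j : Fin 2 → Fin 2 → ℂ)) :
    Measurable f := by
  have hm : (Matrix.specialUnitaryGroup.instMeasurableSpace :
      MeasurableSpace (Matrix.specialUnitaryGroup (Fin 2) ℂ)) =
      MeasurableSpace.comap suEntries (inferInstance : MeasurableSpace (Fin 2 → Fin 2 → ℂ)) :=
    measurableSpace_specialUnitaryGroup_eq_comap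
  rw [measurable_iff_comap_le, hm, MeasurableSpace.comap_comp]
  exact h.comap_le

/-- The set of parameters where a matrix-valued map with measurable entries is special unitary is
measurable (`A Aᴴ = 1 ∧ det A = 1` are polynomial identities in the entries). -/
theorem measurableSet_mem_su2 {α : Type*} {mα : MeasurableSpace α} {f : α → Matrix (Fin 2) (Fin 2) ℂ}
    (h : Measurable fun a => (fun i j => f a i j : Fin 2 → Fin 2 → ℂ)) :
    MeasurableSet {a | f a ∈ Matrix.specialUnitaryGroup (Fin 2) ℂ} := by
  have hij : ∀ i j, Measurable fun a => f a i j := fun i j =>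
    (measurable_pi_apply j).comp ((measurable_pi_apply i).comp h)
  have hset : {a | f a ∈ Matrix.specialUnitaryGroup (Fin 2) ℂ} =
      (⋂ i : Fin 2, ⋂ j : Fin 2, {a | (f a * star (f a)) i j = (1 : Matrix (Fin 2) (Fin 2) ℂ) i j}) ∩
        {a | (f a).det = 1} := by
    ext a
    simp only [Set.mem_setOf_eq, Matrix.mem_specialUnitaryGroup_iff, Matrix.mem_unitaryGroup_iff,
      Set.mem_inter_iff, Set.mem_iInter, ← Matrix.ext_iff]
  rw [hset]
  refine (MeasurableSet.iInter fun i => MeasurableSet.iInter fun j =>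
    measurableSet_eq_fun ?_ measurable_const).inter (measurableSet_eq_fun ?_ measurable_const)
  · simp only [Matrix.mul_apply, Matrix.star_apply]
    exact Finset.measurable_sum _ fun k _ => (hij i k).mul (continuous_star.measurable.comp (hij j k))
  · simp only [Matrix.det_fin_two]
    exact ((hij 0 0).mul (hij 1 1)).sub ((hij 0 1).mul (hij 1 0))

/-- `toSU2 ∘ f` is measurable when the entries of `f` are. -/
theorem measurable_toSU2_comp {α : Type*} {mα : MeasurableSpace α} {f : α → Matrix (Fin 2) (Fin 2) ℂ}
    (h : Measurable fun a => (fun i j => f a i j : Fin 2 → Fin 2 → ℂ)) :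
    Measurable fun a => toSU2 (f a) := by
  classical
  refine measurable_su2_of_entries ?_
  have hfun : (fun a => (fun i j => (toSU2 (f a) : Matrix (Fin 2) (Fin 2) ℂ) i j : Fin 2 → Fin 2 → ℂ)) =
      fun a => if f a ∈ Matrix.specialUnitaryGroup (Fin 2) ℂ then (fun i j => f a i j : Fin 2 → Fin 2 → ℂ)
        else fun i j => (1 : Matrix (Fin 2) (Fin 2) ℂ) i j := by
    funext a
    rw [coe_toSU2]
    split_ifs <;> rfl
  rw [hfun]
  exact Measurable.ite (measurableSet_mem_su2 h) h measurable_const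

/-! ## Composition (kernel-checked): A, B, C, D ⇒ the crux BY NAME -/

/-- **Cold-start strong existence on the product Wiener space from the four stubs.**  Solve the tame
modification `S̃` (C) from `Q₀ ≡ 1 ∈ V^E` (A); the solution stays in `V^E` (A) and keeps `‖X_e‖_F² = 2`
(B, `‖1‖_F² = 2`), so a.s. `X_e(t) ∈ SU(2)` for all `t, e` (D); `U := toSU2 ∘ X` is adapted, a.s.
continuous, starts at `1`, and satisfies the Itô equations of (⋆) through `ρ` (C: `S̃ = (⋆)` on `SU(2)^E`;
the Itô integrands differ from those of `X` on a null set only). -/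
theorem coldStart_of_stubs (hA : __Registered.stub_ambientStrongExistence)
    (hB : __Registered.stub_frobeniusNormPreserved) (L : ℕ) [NeZero L] (β : ℝ)
    (hW : IsFlatBrownian (Wn L) (Pn L)) :
    ∃ U : ℝ≥0 → Ωn L → GaugeConfig 3 L (Matrix.specialUnitaryGroup (Fin 2) ℂ),
      (∀ ω, U 0 ω = fun _ => 1) ∧
      (latticeLangevinDynamics (fundamentalLatticeRep 2) β).IsSolution (fundamentalRep (Fin 2))
        hW.natFiltration (Pn L) (Wn L) U := by
  haveI := isProbabilityMeasure_piWiener (Edge 3 L × NoiseIdx 2)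
  have hD : __Registered.stub_quaternionSphere := stub_quaternionSphere
  have hC : __Registered.stub_truncatedCoefficients := stub_truncatedCoefficients
  obtain ⟨S, hTame, hTan, hAgree⟩ := hC L β
  -- the cold start in matrix coordinates
  set Q₀ : MatrixConfig 3 L 2 := fun _ => 1 with hQ₀def
  have hQ₀V : ∀ e, Q₀ e ∈ V := fun _ => one_mem_spanRange (fundamentalLatticeRep 2)
  have hQ₀sph : ∀ e, hsForm 2 (Q₀ e) (Q₀ e) = 2 := fun _ => by
    have h := hsForm_self_rho (fundamentalLatticeRep 2) 1
    rw [map_one] at h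
    exact_mod_cast h
  obtain ⟨X, hX, hXV⟩ := hA L S hTame hW Q₀ hQ₀V
  have hsph := hB L S hTame hTan hW Q₀ X hX
  obtain ⟨hXad, -, hXc, -, hX0, J, hJ, hXeq⟩ := hX
  -- a.s. the solution is SU(2)-valued at all times
  have hmem : ∀ᵐ ω ∂Pn L, ∀ (t : ℝ≥0) (e : Edge 3 L),
      X t ω e ∈ Matrix.specialUnitaryGroup (Fin 2) ℂ := by
    filter_upwards [hsph, hXV] with ω hω hωV t e
    have h := hD (X t ω e) (hωV t e) (by rw [hω t e, hQ₀sph e])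
    obtain ⟨g, hg⟩ := h
    rw [← hg]
    exact g.2
  -- the process `U`
  refine ⟨fun t ω e => toSU2 (X t ω e), fun ω => ?_, ?_⟩
  · funext e
    show toSU2 (X 0 ω e) = 1
    rw [hX0 ω]
    exact toSU2_one
  have hcoe : ∀ᵐ ω ∂Pn L, ∀ (t : ℝ≥0) (e : Edge 3 L),
      (fundamentalRep (Fin 2)) (toSU2 (X t ω e)) = X t ω e := by
    filter_upwards [hmem] with ω hω t e
    exact coe_toSU2_of_mem (hω t e)
  refine ⟨fun t => ?_, ?_, ⟨J, fun e n i j => ?_, ?_⟩⟩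
  · -- adapted
    letI : MeasurableSpace (Ωn L) := hW.natFiltration t
    exact measurable_pi_lambda _ fun e =>
      measurable_toSU2_comp ((measurable_pi_apply e).comp (hXad t))
  · -- a.s. continuous paths
    filter_upwards [hXc, hmem] with ω hωc hωm
    refine continuous_pi fun e => ?_
    have hval : Continuous fun t => ((toSU2 (X t ω e) : Matrix.specialUnitaryGroup (Fin 2) ℂ) :
        Matrix (Fin 2) (Fin 2) ℂ) := by
      have : (fun t => ((toSU2 (X t ω e) : Matrix.specialUnitaryGroup (Fin 2) ℂ) :
          Matrix (Fin 2) (Fin 2) ℂ)) = fun t => X t ω e := funext fun t => coe_toSU2_of_mem (hωm t e)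
      rw [this]
      exact (continuous_apply e).comp hωc
    exact Topology.IsInducing.subtypeVal.continuous_iff.2 hval
  · -- the Itô integrals: integrands agree a.s. with those of `X`
    refine isItoIntegralC_congr_ae ?_ (hJ e n i j)
    filter_upwards [hcoe] with ω hω t
    have hcfg : matrixConfig (fundamentalRep (Fin 2)) (fun e' => toSU2 (X t ω e')) = X t ω :=
      funext fun e' => hω t e'
    have h2 := (hAgree (fun e' => toSU2 (X t ω e')) e).2 n
    rw [hcfg] at h2
    -- goal: (⋆).noise (ρ ∘ U t ω) e n i j = S.noise (X t ω) e n i j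
    exact (congrFun (congrFun h2 i) j).symm
  · -- the integral equations
    filter_upwards [hXeq, hcoe] with ω hω hωc t e i j
    have hcfg : ∀ s : ℝ≥0, matrixConfig (fundamentalRep (Fin 2)) (fun e' => toSU2 (X s ω e')) = X s ω :=
      fun s => funext fun e' => hωc s e'
    have hdrift : ∀ s : ℝ≥0, (latticeLangevinDynamics (fundamentalLatticeRep 2) β).drift
        (matrixConfig (fundamentalRep (Fin 2)) (fun e' => toSU2 (X s ω e'))) e i j = S.drift (X s ω) e i j := by
      intro s
      have h1 := (hAgree (fun e' => toSU2 (X s ω e')) e).1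
      rw [hcfg] at h1
      exact (congrFun (congrFun h1 i) j).symm
    have hlhs : (fundamentalRep (Fin 2)) (toSU2 (X t ω e)) i j = X t ω e i j :=
      congrFun (congrFun (hωc t e) i) j
    have h0 : (fundamentalRep (Fin 2)) (toSU2 (X 0 ω e)) i j = Q₀ e i j := by
      rw [congrFun (congrFun (hωc 0 e) i) j, hX0 ω]
    have hint : (∫ s in (0 : ℝ)..t, (latticeLangevinDynamics (fundamentalLatticeRep 2) β).drift
          (matrixConfig (fundamentalRep (Fin 2)) (fun e' => toSU2 (X s.toNNReal ω e'))) e i j) =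
        ∫ s in (0 : ℝ)..t, S.drift (X s.toNNReal ω) e i j :=
      intervalIntegral.integral_congr fun s _ => hdrift s.toNNReal
    calc (fundamentalRep (Fin 2)) (toSU2 (X t ω e)) i j = X t ω e i j := hlhs
      _ = Q₀ e i j + (∫ s in (0 : ℝ)..t, S.drift (X s.toNNReal ω) e i j) + ∑ n, J e n i j t ω :=
          hω t e i j
      _ = (fundamentalRep (Fin 2)) (toSU2 (X 0 ω e)) i j +
            (∫ s in (0 : ℝ)..t, (latticeLangevinDynamics (fundamentalLatticeRep 2) β).drift
              (matrixConfig (fundamentalRep (Fin 2)) (fun e' => toSU2 (X s.toNNReal ω e'))) e i j) +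
            ∑ n, J e n i j t ω := by rw [h0, hint]

/-- **Composition.** The four stubs give the support statement S BY NAME (`L := N_K`,
`β := (γ ε_K)⁻¹/2`, flat Brownian property of the coordinate family proved). -/
theorem ColdStartSolutionsExist_of (hA : __Registered.stub_ambientStrongExistence)
    (hB : __Registered.stub_frobeniusNormPreserved) : ColdStartSolutionsExist := by
  intro F γ K _hγ
  haveI := isProbabilityMeasure_piWiener (Edge 3 ((F.P K).sitesPerDir 0) × NoiseIdx 2)
  obtain ⟨U, hU0, hsol⟩ := coldStart_of_stubs hA hB ((F.P K).sitesPerDir 0)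
    ((γ * (F.P K).eps)⁻¹ / 2) (isFlatBrownian_Wn _)
  exact ⟨Ωn ((F.P K).sitesPerDir 0), inferInstance, Pn _, inferInstance, Wn _, isFlatBrownian_Wn _,
    U, hU0, hsol⟩

/-- **Composition, v6.** The crux BY NAME from the single open stub B1 (`stub_tangentSumSq`): stub A is
proved (`stub_ambientStrongExistence`), stub B follows from B1 (`stub_frobeniusNormPreserved_of`). -/
theorem ColdStartSolutionsExist_of_tangent (hT : __Registered.stub_tangentSumSq) : ColdStartSolutionsExist :=
  ColdStartSolutionsExist_of stub_ambientStrongExistence (stub_frobeniusNormPreserved_of hT)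

/-- The crux BY NAME from the stubs. -/
theorem ColdStartSolutionsExist_holds_of_stubs : ColdStartSolutionsExist :=
  ColdStartSolutionsExist_of_tangent stub_tangentSumSq

end Summit.QuantumFields.YangMills.Cruxes.ColdStartSolutionsExist.Piwiener

end
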